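import Mathlib
import Literature.AlgebraicGeometry.Resolution.HenselizationHenselian
import Literature.AlgebraicGeometry.Resolution.HenselizationSeparablyDefectless
import Literature.AlgebraicGeometry.Resolution.Kuhlmann2019HenselianRationalityLemmas
import Literature.AlgebraicGeometry.Resolution.HenselizedFunctionFieldsBaseChangeLemmas
import Literature.AlgebraicGeometry.Resolution.SeparatingTranscendenceBasis

/-!
# Defectlessness over the henselization from separable defectlessness below (shared tail)

Crux `DefectlessFramesR`, line `Sketch`; shared final step of the stubs `stub_dfrAbhyankar` and
`stub_dfrDiscrete`. Inside an algebraically closed valued field `(Ω, V)` let `F ≤ Ω` be a subfield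
such that `(F, V ∩ F)` is separably defectless, and let `ζ ∈ Ω` be separable over `F`. Then
`F^h(ζ)` is a defectless extension of the henselization `F^h` (`IsDefectlessExtension`):

* `F^h` is henselian (`Kuhlmann2010HenselizationIsHenselian_holds`) and separably defectless
  (`Kuhlmann2010SeparablyDefectlessIffHenselization_holds`);
* `F^h(ζ) | F^h` is finite (ζ is algebraic over `F ≤ F^h`) and separable (ζ is separable over `F^h`);
* so `[F^h(ζ) : F^h] = (v F^h(ζ) : v F^h) · [F^h(ζ)v : F^h v]`
  (`relfinrank_eq_relIndex_mul_relfinrank_of_isSeparablyDefectlessField`).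

`stub_dfrDefectTail` specialises this to the frame rendering of the crux: `K = k(y', z')` with `z'`
separable over `k(y')`, `F` the image of `k(y')` in `Ω ⊇ K`, `T = F^h · K = F^h(z')`.
-/

namespace Summit.ResolutionOfSingularities.ResolutionOfSingularities.Theorems

open Literature.AlgebraicGeometry.Resolution

universe u

/-- **Shared tail.** For `Ω` algebraically closed with valuation ring `V`, a subfield `F ≤ Ω` with
`(F, V ∩ F)` separably defectless, `ζ ∈ Ω` separable over `F`, and a subfield `T` with
`F^h ≤ T ≤ F^h(ζ)`, `ζ ∈ T` (so `T = F^h(ζ)`): `T` is a defectless extension of the henselization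
`F^h = henselization V F`, i.e. `[T : F^h] = (vT : vF^h)·[Tv : F^h v]`. Indeed `F^h` is henselian and
separably defectless (Kuhlmann 2010, Lemma 2.3 and Thm. 2.14, proved in the tree), and `T | F^h` is
finite separable. [folklore] -/
theorem dfr_isDefectlessExtension_of_isSeparablyDefectlessField {Ω : Type u} [Field Ω]
    [IsAlgClosed Ω] (V : ValuationSubring Ω) (F : Subfield Ω) (ζ : Ω) (hsep : IsSeparable F ζ)
    (hsd : IsSeparablyDefectlessField F (V.comap (algebraMap F Ω))) (T : Subfield Ω)
    (hT : henselization V F ≤ T) (hgen : T ≤ Subfield.closure (↑(henselization V F) ∪ {ζ}))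
    (hζT : ζ ∈ T) : IsDefectlessExtension V (henselization V F) T := by
  have hH : IsHenselianField (henselization V F) (V.comap (algebraMap (henselization V F) Ω)) :=
    Kuhlmann2010HenselizationIsHenselian_holds Ω V F
  have hsdh : IsSeparablyDefectlessField (henselization V F)
      (V.comap (algebraMap (henselization V F) Ω)) :=
    (Kuhlmann2010SeparablyDefectlessIffHenselization_holds Ω V F).mp hsd
  have hsepζ : IsSeparable (henselization V F) ζ := IsSeparable.tower_top (henselization V F) hsep
  have hint : IsIntegral (henselization V F) ζ := hsepζ.isIntegral
  set A : IntermediateField (henselization V F) Ω :=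
    IntermediateField.adjoin (henselization V F) ({ζ} : Set Ω) with hA
  have hTeq : T = A.toSubfield := by
    refine le_antisymm (hgen.trans (Subfield.closure_le.mpr ?_)) (adjoin_simple_toSubfield_le hT hζT)
    exact Set.union_subset (subfield_le_toSubfield A)
      (Set.singleton_subset_iff.mpr (IntermediateField.mem_adjoin_simple_self _ ζ))
  have hpos : 0 < Subfield.relfinrank (henselization V F) T := by
    rw [hTeq, hA, relfinrank_adjoin_simple_eq_natDegree _ hint]
    exact minpoly.natDegree_pos hint
  have hsepT : ∀ a ∈ T, IsSeparable (henselization V F) a := by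
    intro a ha
    rw [hTeq] at ha
    haveI : Algebra.IsSeparable (henselization V F) A :=
      (IntermediateField.isSeparable_adjoin_simple_iff_isSeparable (F := henselization V F) (E := Ω)).mpr hsepζ
    exact IntermediateField.isSeparable_of_mem_isSeparable _ Ω (show a ∈ A from ha)
  exact ⟨hT, hpos,
    relfinrank_eq_relIndex_mul_relfinrank_of_isSeparablyDefectlessField V hT hH hsdh hpos hsepT⟩

/-- **Shared tail, frame rendering** (helper stub `stub_dfrDefectTail` of crux `DefectlessFramesR`,
line `Sketch`). Let `K = k(y', z')` with `z'` separable over `k(y')`, `Ω ⊇ K` algebraically closed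
with valuation ring `V`, `F ≤ Ω` the image of `k(y')` and `F^h = henselization V F`. If `(F, V ∩ F)`
is separably defectless, then `F^h · K = F^h(z')` is a defectless extension of `F^h`: `z'` is
separable over `F ≅ k(y')`, `F^h · K` is generated over `F^h` by `z'`, and
`dfr_isDefectlessExtension_of_isSeparablyDefectlessField` applies. [folklore] -/
theorem stub_dfrDefectTail : ∀ (k K : Type) [Field k] [Field K] [Algebra k K] (n : ℕ) (y' : Fin n → K) (z' : K), IntermediateField.adjoin k (Set.range y' ∪ {z'}) = ⊤ → IsSeparable (IntermediateField.adjoin k (Set.range y')) z' → ∀ (Ω : Type) [Field Ω] [IsAlgClosed Ω] [Algebra K Ω] (V : ValuationSubring Ω), let F : Subfield Ω := (IntermediateField.adjoin k (Set.range y')).toSubfield.map (algebraMap K Ω); Literature.AlgebraicGeometry.Resolution.IsSeparablyDefectlessField F (V.comap (algebraMap F Ω)) → Literature.AlgebraicGeometry.Resolution.IsDefectlessExtension V (Literature.AlgebraicGeometry.Resolution.henselization V F) (Literature.AlgebraicGeometry.Resolution.henselization V F ⊔ (algebraMap K Ω).fieldRange) := by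
  intro k K _ _ _ n y' z' hadj hsep Ω _ _ _ V F hsd
  set F' : IntermediateField k K := IntermediateField.adjoin k (Set.range y') with hF'
  set ζ : Ω := algebraMap K Ω z' with hζ
  have hFFh : F ≤ henselization V F := le_henselization V F
  have hFmem : ∀ x ∈ F', algebraMap K Ω x ∈ F := fun x hx => Subfield.mem_map.mpr ⟨x, hx, rfl⟩
  have hkF : ∀ c : k, algebraMap K Ω (algebraMap k K c) ∈ F := fun c =>
    hFmem _ (IntermediateField.algebraMap_mem _ c)
  have hyF : ∀ i, algebraMap K Ω (y' i) ∈ F := fun i =>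
    hFmem _ (IntermediateField.subset_adjoin k _ ⟨i, rfl⟩)
  -- `ζ` is separable over `F ≅ k(y')`
  let f : F' →+* F := ((algebraMap K Ω).comp (algebraMap F' K)).codRestrict F fun x => hFmem x x.2
  have hsepΩ : IsSeparable F' ζ :=
    hsep.map (IsScalarTower.toAlgHom F' K Ω) (algebraMap K Ω).injective
  have hsepF : IsSeparable F ζ := isSeparable_of_ringHom_comp_eq f (RingHom.ext fun _ => rfl) hsepΩ
  -- `F^h · K ≤ F^h(ζ)`
  set T : Subfield Ω := henselization V F ⊔ (algebraMap K Ω).fieldRange with hT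
  have hFhT : henselization V F ≤ T := le_sup_left
  have hζT : ζ ∈ T :=
    (le_sup_right : (algebraMap K Ω).fieldRange ≤ T) (RingHom.mem_fieldRange.mpr ⟨z', rfl⟩)
  have hgen : T ≤ Subfield.closure (↑(henselization V F) ∪ {ζ}) := by
    -- adapted from the proof of `stub_dfrSmallAxis` (`F^h · K = F^h(ζ)`)
    refine sup_le (fun x hx => Subfield.subset_closure (Or.inl hx)) fun x hx => ?_
    obtain ⟨w, rfl⟩ := RingHom.mem_fieldRange.mp hx
    set C : Subfield Ω := Subfield.closure (↑(henselization V F) ∪ {ζ}) with hC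
    have hFC : F ≤ C := fun x hx => Subfield.subset_closure (Or.inl (hFFh hx))
    let J : IntermediateField k K :=
      (C.comap (algebraMap K Ω)).toIntermediateField fun c => Subfield.mem_comap.mpr (hFC (hkF c))
    have hJ : IntermediateField.adjoin k (Set.range y' ∪ {z'}) ≤ J := by
      rw [IntermediateField.adjoin_le_iff]
      rintro x (⟨i, rfl⟩ | hx)
      · exact Subfield.mem_comap.mpr (hFC (hyF i))
      · rw [Set.mem_singleton_iff.mp hx]
        exact Subfield.mem_comap.mpr (Subfield.subset_closure (Or.inr rfl))
    have hw : w ∈ J := hJ (show w ∈ IntermediateField.adjoin k _ by rw [hadj]; trivial)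
    exact Subfield.mem_comap.mp hw
  exact dfr_isDefectlessExtension_of_isSeparablyDefectlessField V F ζ hsepF hsd T hFhT hgen hζT

end Summit.ResolutionOfSingularities.ResolutionOfSingularities.Theorems
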